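import Mathlib
import HarnessLib
import Summits.HubbardSuperconductivity.HubbardSuperconductivity.Theorems.KLProgrammeKLRegimeEnginePairTransferDLineEdgeSplit3Door
import Summits.HubbardSuperconductivity.HubbardSuperconductivity.Theorems.KLProgrammeKLRegimeEnginePairTransferDLineEdgeSplit3SharpZS

/-!
# Route `KLProgramme` — ENGINE item stmt-HubbardSuperconductivity-20437 `KLRegimeEngineV17F2`, class-#5 STEP (X).3 budget side, THE PINNED PAIR «88b» /
# located-risk #14 «(X).3-PINNED-NUMERIC»: THE DOOR and THE ROOM SLOTS keyed on the SHARP row bound `klmsRowBoundS`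
# (cell gate-hubbard-kl, seat hubbard-kl-k3c2-p2 g22, technique «thermal-bar induction n ≤ nScales β + 1 with EngineBoundsAtV4S sums»)

Text-faithful twins (suffix `S`) of `pinned_rowBound_reading`, `pinned_row_le_slots`, `pinned_row_le_slots_shift` (…DLineEdgeForward §3) and
`dLine_pinned_direct/crossed_split3_door` (…DLineEdgeSplit3Door) with `klmsRowBound ↦ klmsRowBoundS`: the zero-sound slot constant
`ZS⋆ = (524288/π)·(64·16 + (2B₂+8) + 64)·geo` becomes `ZS⋆_S = (64/π)·8·geo` (`geo = π√2/(d−4A)·(2L_A + 40A₀)/(d−4A) + 2A₀(1/(d−4A)² + π√2(2+4A)/(d−4A)³)`),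
i.e. smaller by `524288·3303.4/512 ≈ 2^21.7` at `j = n+2`; `TH⋆`, `TR⋆`, `LAT⋆`, the flatness/window numerals and every hypothesis are unchanged.  These are the
rows k3c1's «88b» ADAPTER reads (five-slot scalar form `(KlamU)²·(z·4^{−(n+1)} + h·4^{−(n_β−n)} + w·2⁻ⁿ + l/L + t·min)`): with the sharp `z` the forward
zero-sound entry of CLASS5-RESOLVED-STEP §17 (`r ≥ 2^23.3·a₀ + 2^18.7·l₁` at d = ½) leaves the register (`r ≥ 2^2·a₀`).
Pure composition + real arithmetic over landed rows; nothing asserts (X).3, (c), K3 or superconductivity.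
-/

noncomputable section

namespace Summit.HubbardSuperconductivity.HubbardSuperconductivity.Theorems.KLRegimeSplit

set_option linter.dupNamespace false -- summit = problem name (single-conjunct summit), D-0017

open Real Set Finset Complex Literature.MathematicalPhysics.QuantumLattice
open Literature.Probability.LatticeModels hiding torusSupNorm
open Literature.MathematicalPhysics.QuantumLattice.BandSectorCounting
open Summit.HubbardSuperconductivity.HubbardSuperconductivity.Theorems.KLProgrammeLegKernels
open Summit.HubbardSuperconductivity.HubbardSuperconductivity.Theorems.KLRegimeWick
open Summit.HubbardSuperconductivity.HubbardSuperconductivity.Theorems.TwoPointAssembly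
open Summit.HubbardSuperconductivity.HubbardSuperconductivity.Theorems.DispersionFlow
open Summit.HubbardSuperconductivity.HubbardSuperconductivity.Theorems.PerturbedFermiCurve

variable {L M : ℕ} [NeZero L] [NeZero M] (β μ : ℝ) (K : TrigPolyC4v)

/-! ## §1 The sharp pinned row in the ROOM's monomials (twins of …DLineEdgeForward §3) -/

omit [NeZero M] in
/-- **EXACT READING of the pinned row at index `n+2`** (`(Λₙ₊₁/Λₙ₊₂)² = 16`, `16^{(n+2)−(n+1)} = 16`):
`(Λₙ − Λₙ₊₁)·klmsRowBoundS d A G A₀ L_A β n (n+2) δ L = (3/(2π))·(ZS⋆·Λₙ₊₁ + TH⋆·((π/β)/Λₙ₊₁) + TR⋆·((|0| + δ)/Λₙ₊₁)) + LAT⋆/L` with the closed constants displayed. -/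
theorem pinned_rowBound_readingS (d A G A₀ La : ℝ) (n : ℕ) (δ : ℝ) :
    (klScale klE0 n - klScale klE0 (n + 1)) * klmsRowBoundS d A G A₀ La β n (n + 2) δ L =
      3 / (2 * π) *
          ((64 / Real.pi * 8 *
                (Real.pi * Real.sqrt 2 / (d - 4 * A) * (2 * La + 2 * A₀ * (2 / (1 / 10))) / (d - 4 * A) +
                  2 * A₀ * (1 / (d - 4 * A) ^ 2 + Real.pi * Real.sqrt 2 * (2 + 4 * A) / (d - 4 * A) ^ 3))) *
              klScale klE0 (n + 1) +
            (393216 / Real.pi * (64 * 16 + (2 * (448 / 3 * Real.exp 2) + 8) + 64) *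
                (2 * A₀ * (Real.pi * Real.sqrt 2 / (d - 4 * A)))) *
              ((Real.pi / β) / klScale klE0 (n + 1)) +
            (256 / Real.pi * 8 * (2 * A₀ * (Real.pi * Real.sqrt 2 / (d - 4 * A))) * (65 * (8 * (16 : ℝ)) + 17408 / 3 * 1)) *
              ((|(0 : ℝ)| + δ) / klScale klE0 (n + 1))) +
        96 * (512 * La / klScale klE0 (n + 1) +
            32 * A₀ * G * ((9 * (2 * (448 / 3 * Real.exp 2) + 8) + 4 * 8) + (65 * (8 * (16 : ℝ)) + 17408 / 3 * 1)) /
              klScale klE0 (n + 1) ^ 2) / L := by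
  have h16 : (klScale klE0 (n + 1) / klScale klE0 (n + 2)) ^ 2 = 16 := by
    rw [klth_klScale_succ (n + 1)]; have h := (klth_klScale_pos (n + 1)).ne'; field_simp; norm_num
  have hpow : (16 : ℝ) ^ (n + 2 - (n + 1)) = 16 := by rw [show n + 2 - (n + 1) = 1 by omega, pow_one]
  rw [klmsRowBoundS_reading, h16, hpow]

omit [NeZero M] in
/-- **THE PINNED ROW IN THE ROOM's MONOMIALS** (`δ = G·r`, forward window `0 < r ≤ Λₙ₊₁`, `n ≤ n_β`, `klBetaMin ≤ β`, `0 < d − 4A`, `0 ≤ A`, `A₀, L_A ≥ 0`):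
`2·(Λₙ−Λₙ₊₁)·Row_{n+2}(G·r) ≤ (3/π)·ZS⋆·klE0·(4ⁿ⁺¹)⁻¹ + (12/π)·TH⋆·(4^{n_β−n})⁻¹ + (3/π)·TR⋆·G·min(r/Λₙ₊₁, Λₙ₊₁/r) + 2·LAT⋆/L`
— the ROOM's `(4ⁿ⁺¹)⁻¹·klIdxOverlap (n+1) (n+1)`, `3·thermalBar (n+1)`, `min_d` and `1/L` monomials of `transferBarRelIdx_succ_room` (this lineage's thermal dictionary
`(π/β)/Λₙ₊₁ ≤ 4·4^{−(n_β−n)}`, `klmsRoom_thermal_le`). -/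
theorem pinned_row_le_slotsS {d A G A₀ La : ℝ} (hdA : 0 < d - 4 * A) (hA : 0 ≤ A) (hA0 : 0 ≤ A₀) (hLa : 0 ≤ La)
    (hβ : klBetaMin ≤ β) {n : ℕ} (hn : n ≤ nScales β) {r : ℝ} (hr : 0 < r) (hrΛ : r ≤ klScale klE0 (n + 1)) :
    2 * ((klScale klE0 n - klScale klE0 (n + 1)) * klmsRowBoundS d A G A₀ La β n (n + 2) (G * r) L) ≤
      3 / π * (64 / Real.pi * 8 *
              (Real.pi * Real.sqrt 2 / (d - 4 * A) * (2 * La + 2 * A₀ * (2 / (1 / 10))) / (d - 4 * A) +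
                2 * A₀ * (1 / (d - 4 * A) ^ 2 + Real.pi * Real.sqrt 2 * (2 + 4 * A) / (d - 4 * A) ^ 3))) *
          klE0 * ((4 : ℝ) ^ (n + 1))⁻¹ +
        12 / π * (393216 / Real.pi * (64 * 16 + (2 * (448 / 3 * Real.exp 2) + 8) + 64) * (2 * A₀ * (Real.pi * Real.sqrt 2 / (d - 4 * A)))) *
          ((4 : ℝ) ^ (nScales β - n))⁻¹ +
        3 / π * (256 / Real.pi * 8 * (2 * A₀ * (Real.pi * Real.sqrt 2 / (d - 4 * A))) * (65 * (8 * (16 : ℝ)) + 17408 / 3 * 1)) *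
          (G * min (r / klScale klE0 (n + 1)) (klScale klE0 (n + 1) / r)) +
        2 * (96 * (512 * La / klScale klE0 (n + 1) +
            32 * A₀ * G * ((9 * (2 * (448 / 3 * Real.exp 2) + 8) + 4 * 8) + (65 * (8 * (16 : ℝ)) + 17408 / 3 * 1)) /
              klScale klE0 (n + 1) ^ 2) / L) := by
  have hπ := Real.pi_pos
  have hβ0 : 0 < β := lt_of_lt_of_le (by norm_num [klBetaMin]) hβ
  have hΛ1 := klth_klScale_pos (n + 1)
  rw [pinned_rowBound_readingS]
  -- abbreviate the closed constants
  set ZS : ℝ := 64 / Real.pi * 8 *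
      (Real.pi * Real.sqrt 2 / (d - 4 * A) * (2 * La + 2 * A₀ * (2 / (1 / 10))) / (d - 4 * A) +
        2 * A₀ * (1 / (d - 4 * A) ^ 2 + Real.pi * Real.sqrt 2 * (2 + 4 * A) / (d - 4 * A) ^ 3)) with hZS
  set TH : ℝ := 393216 / Real.pi * (64 * 16 + (2 * (448 / 3 * Real.exp 2) + 8) + 64) * (2 * A₀ * (Real.pi * Real.sqrt 2 / (d - 4 * A))) with hTH
  set TR : ℝ := 256 / Real.pi * 8 * (2 * A₀ * (Real.pi * Real.sqrt 2 / (d - 4 * A))) * (65 * (8 * (16 : ℝ)) + 17408 / 3 * 1) with hTR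
  set LAT : ℝ := 96 * (512 * La / klScale klE0 (n + 1) +
      32 * A₀ * G * ((9 * (2 * (448 / 3 * Real.exp 2) + 8) + 4 * 8) + (65 * (8 * (16 : ℝ)) + 17408 / 3 * 1)) / klScale klE0 (n + 1) ^ 2) with hLAT
  obtain ⟨hZS0, hTH0, hTR0⟩ : 0 ≤ ZS ∧ 0 ≤ TH ∧ 0 ≤ TR := ⟨by rw [hZS]; positivity, by rw [hTH]; positivity, by rw [hTR]; positivity⟩
  -- the three dictionary lines
  have hΛeq : klScale klE0 (n + 1) = klE0 * ((4 : ℝ) ^ (n + 1))⁻¹ := rfl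
  have hth := klmsRoom_thermal_le hβ hn
  have hmin : (|(0 : ℝ)| + G * r) / klScale klE0 (n + 1) = G * min (r / klScale klE0 (n + 1)) (klScale klE0 (n + 1) / r) := by
    rw [← div_eq_min_of_le hr hrΛ, abs_zero, zero_add, mul_div_assoc]
  rw [hmin]
  have h1 : 3 / (2 * π) * (ZS * klScale klE0 (n + 1)) = 1 / 2 * (3 / π * ZS * klE0 * ((4 : ℝ) ^ (n + 1))⁻¹) := by rw [hΛeq]; ring
  have h2 : 3 / (2 * π) * (TH * ((Real.pi / β) / klScale klE0 (n + 1))) ≤ 1 / 2 * (12 / π * TH * ((4 : ℝ) ^ (nScales β - n))⁻¹) := by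
    have := mul_le_mul_of_nonneg_left hth (by positivity : 0 ≤ 3 / (2 * π) * TH)
    calc 3 / (2 * π) * (TH * ((Real.pi / β) / klScale klE0 (n + 1))) = 3 / (2 * π) * TH * ((Real.pi / β) / klScale klE0 (n + 1)) := by ring
      _ ≤ 3 / (2 * π) * TH * (4 * ((4 : ℝ) ^ (nScales β - n))⁻¹) := this
      _ = 1 / 2 * (12 / π * TH * ((4 : ℝ) ^ (nScales β - n))⁻¹) := by ring
  have h3 : 3 / (2 * π) * (TR * (G * min (r / klScale klE0 (n + 1)) (klScale klE0 (n + 1) / r))) =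
      1 / 2 * (3 / π * TR * (G * min (r / klScale klE0 (n + 1)) (klScale klE0 (n + 1) / r))) := by ring
  have hsplit : 3 / (2 * π) * (ZS * klScale klE0 (n + 1) + TH * ((Real.pi / β) / klScale klE0 (n + 1)) + TR * (G * min (r / klScale klE0 (n + 1)) (klScale klE0 (n + 1) / r))) =
      3 / (2 * π) * (ZS * klScale klE0 (n + 1)) + 3 / (2 * π) * (TH * ((Real.pi / β) / klScale klE0 (n + 1))) +
        3 / (2 * π) * (TR * (G * min (r / klScale klE0 (n + 1)) (klScale klE0 (n + 1) / r))) := by ring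
  rw [hsplit, h1, h3]
  linarith

omit [NeZero M] in
/-- **THE SHIFTED PINNED ROW IN THE ROOM's MONOMIALS** (crossed row: `δ = |±2π/β| + G·r`; the bosonic shift is thermal, `(2π/β)/Λₙ₊₁ ≤ 8·4^{−(n_β−n)}`):
`2·(Λₙ−Λₙ₊₁)·Row_{n+2}(|±2π/β| + G·r) ≤ (3/π)·ZS⋆·klE0·(4ⁿ⁺¹)⁻¹ + (12/π)·(TH⋆ + 2·TR⋆)·(4^{n_β−n})⁻¹ + (3/π)·TR⋆·G·min(r/Λₙ₊₁, Λₙ₊₁/r) + 2·LAT⋆/L`. -/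
theorem pinned_row_le_slots_shiftS {d A G A₀ La : ℝ} (hdA : 0 < d - 4 * A) (hA : 0 ≤ A) (hG : 0 ≤ G) (hA0 : 0 ≤ A₀) (hLa : 0 ≤ La)
    (hβ : klBetaMin ≤ β) {n : ℕ} (hn : n ≤ nScales β) {r : ℝ} (hr : 0 < r) (hrΛ : r ≤ klScale klE0 (n + 1)) {s : ℝ} (hs : |s| = 2 * π / β) :
    2 * ((klScale klE0 n - klScale klE0 (n + 1)) * klmsRowBoundS d A G A₀ La β n (n + 2) (|s| + G * r) L) ≤
      3 / π * (64 / Real.pi * 8 *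
              (Real.pi * Real.sqrt 2 / (d - 4 * A) * (2 * La + 2 * A₀ * (2 / (1 / 10))) / (d - 4 * A) +
                2 * A₀ * (1 / (d - 4 * A) ^ 2 + Real.pi * Real.sqrt 2 * (2 + 4 * A) / (d - 4 * A) ^ 3))) *
          klE0 * ((4 : ℝ) ^ (n + 1))⁻¹ +
        12 / π * (393216 / Real.pi * (64 * 16 + (2 * (448 / 3 * Real.exp 2) + 8) + 64) * (2 * A₀ * (Real.pi * Real.sqrt 2 / (d - 4 * A))) +
            2 * (256 / Real.pi * 8 * (2 * A₀ * (Real.pi * Real.sqrt 2 / (d - 4 * A))) * (65 * (8 * (16 : ℝ)) + 17408 / 3 * 1))) *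
          ((4 : ℝ) ^ (nScales β - n))⁻¹ +
        3 / π * (256 / Real.pi * 8 * (2 * A₀ * (Real.pi * Real.sqrt 2 / (d - 4 * A))) * (65 * (8 * (16 : ℝ)) + 17408 / 3 * 1)) *
          (G * min (r / klScale klE0 (n + 1)) (klScale klE0 (n + 1) / r)) +
        2 * (96 * (512 * La / klScale klE0 (n + 1) +
            32 * A₀ * G * ((9 * (2 * (448 / 3 * Real.exp 2) + 8) + 4 * 8) + (65 * (8 * (16 : ℝ)) + 17408 / 3 * 1)) /
              klScale klE0 (n + 1) ^ 2) / L) := by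
  have hπ := Real.pi_pos
  have hβ0 : 0 < β := lt_of_lt_of_le (by norm_num [klBetaMin]) hβ
  have hΛ1 := klth_klScale_pos (n + 1)
  rw [pinned_rowBound_readingS, hs]
  set ZS : ℝ := 64 / Real.pi * 8 *
      (Real.pi * Real.sqrt 2 / (d - 4 * A) * (2 * La + 2 * A₀ * (2 / (1 / 10))) / (d - 4 * A) +
        2 * A₀ * (1 / (d - 4 * A) ^ 2 + Real.pi * Real.sqrt 2 * (2 + 4 * A) / (d - 4 * A) ^ 3)) with hZS
  set TH : ℝ := 393216 / Real.pi * (64 * 16 + (2 * (448 / 3 * Real.exp 2) + 8) + 64) * (2 * A₀ * (Real.pi * Real.sqrt 2 / (d - 4 * A))) with hTH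
  set TR : ℝ := 256 / Real.pi * 8 * (2 * A₀ * (Real.pi * Real.sqrt 2 / (d - 4 * A))) * (65 * (8 * (16 : ℝ)) + 17408 / 3 * 1) with hTR
  set LAT : ℝ := 96 * (512 * La / klScale klE0 (n + 1) +
      32 * A₀ * G * ((9 * (2 * (448 / 3 * Real.exp 2) + 8) + 4 * 8) + (65 * (8 * (16 : ℝ)) + 17408 / 3 * 1)) / klScale klE0 (n + 1) ^ 2) with hLAT
  obtain ⟨hZS0, hTH0, hTR0⟩ : 0 ≤ ZS ∧ 0 ≤ TH ∧ 0 ≤ TR := ⟨by rw [hZS]; positivity, by rw [hTH]; positivity, by rw [hTR]; positivity⟩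
  have hΛeq : klScale klE0 (n + 1) = klE0 * ((4 : ℝ) ^ (n + 1))⁻¹ := rfl
  have hth := klmsRoom_thermal_le hβ hn
  set q : ℝ := ((4 : ℝ) ^ (nScales β - n))⁻¹ with hq
  set mn : ℝ := min (r / klScale klE0 (n + 1)) (klScale klE0 (n + 1) / r) with hmn
  have hsplit : (|(0 : ℝ)| + (2 * π / β + G * r)) / klScale klE0 (n + 1) = 2 * ((Real.pi / β) / klScale klE0 (n + 1)) + G * mn := by
    rw [hmn, ← div_eq_min_of_le hr hrΛ, abs_zero, zero_add]
    field_simp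
  rw [hsplit]
  have h1 : 3 / (2 * π) * (ZS * klScale klE0 (n + 1)) = 1 / 2 * (3 / π * ZS * klE0 * ((4 : ℝ) ^ (n + 1))⁻¹) := by rw [hΛeq]; ring
  have hth' : (Real.pi / β) / klScale klE0 (n + 1) ≤ 4 * q := hth
  have hth0 : 0 ≤ (Real.pi / β) / klScale klE0 (n + 1) := by positivity
  have hmn0 : 0 ≤ mn := by rw [hmn]; exact le_min (by positivity) (by positivity)
  have h2 : 3 / (2 * π) * (TH * ((Real.pi / β) / klScale klE0 (n + 1))) ≤ 1 / 2 * (12 / π * TH * q) := by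
    have := mul_le_mul_of_nonneg_left hth' (by positivity : 0 ≤ 3 / (2 * π) * TH)
    calc 3 / (2 * π) * (TH * ((Real.pi / β) / klScale klE0 (n + 1))) = 3 / (2 * π) * TH * ((Real.pi / β) / klScale klE0 (n + 1)) := by ring
      _ ≤ 3 / (2 * π) * TH * (4 * q) := this
      _ = 1 / 2 * (12 / π * TH * q) := by ring
  have h3 : 3 / (2 * π) * (TR * (2 * ((Real.pi / β) / klScale klE0 (n + 1)) + G * mn)) ≤ 1 / 2 * (12 / π * (2 * TR) * q) + 1 / 2 * (3 / π * TR * (G * mn)) := by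
    have := mul_le_mul_of_nonneg_left hth' (by positivity : 0 ≤ 3 / (2 * π) * TR * 2)
    calc 3 / (2 * π) * (TR * (2 * ((Real.pi / β) / klScale klE0 (n + 1)) + G * mn))
        = 3 / (2 * π) * TR * 2 * ((Real.pi / β) / klScale klE0 (n + 1)) + 1 / 2 * (3 / π * TR * (G * mn)) := by ring
      _ ≤ 3 / (2 * π) * TR * 2 * (4 * q) + 1 / 2 * (3 / π * TR * (G * mn)) := by linarith
      _ = 1 / 2 * (12 / π * (2 * TR) * q) + 1 / 2 * (3 / π * TR * (G * mn)) := by ring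
  have hsum : 3 / (2 * π) * (ZS * klScale klE0 (n + 1) + TH * ((Real.pi / β) / klScale klE0 (n + 1)) + TR * (2 * ((Real.pi / β) / klScale klE0 (n + 1)) + G * mn)) =
      3 / (2 * π) * (ZS * klScale klE0 (n + 1)) + 3 / (2 * π) * (TH * ((Real.pi / β) / klScale klE0 (n + 1))) +
        3 / (2 * π) * (TR * (2 * ((Real.pi / β) / klScale klE0 (n + 1)) + G * mn)) := by ring
  rw [hsum, h1]
  have e12 : 12 / π * (TH + 2 * TR) * q = 12 / π * TH * q + 12 / π * (2 * TR) * q := by ring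
  rw [e12]
  linarith

/-! ## §2 The three-way split rows in the door's normalisation, sharp row bound (twins of …DLineEdgeSplit3Door) -/

section Door

variable {a' b' : ℝ} (B : BandBounds a' b') {R : RenConsts} {U : ℝ} {N : ℕ} {A : ℝ}

/-- **DIRECT THREE-WAY SPLIT ROW IN THE DOOR's NORMALISATION**: `(Λₙ−Λₙ₊₁)((βL²)³)⁻¹·‖S_D‖ ≤ 2(Λₙ−Λₙ₊₁)Row_{n+2}(2‖c‖,0) + 2(Λₙ−Λₙ₊₁)Row_{n+2}(A₁,L₁) + ε₁·(512·15367) +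
A₂·(1024·15381)·(ρ/π + 1/L)` (the two ROOM rows are `pinned_row_le_slotsS`' input; hypotheses as `dLine_pinned_direct_signed_le_split3S`). -/
theorem dLine_pinned_direct_split3_doorS (hR : ∀ j, 0 ≤ R.Gfr j) (hK : FrameOK R U N μ K)
    (hAb : ∀ p : Momentum, ∀ j ≤ 2, ‖iteratedFDeriv ℝ j (frameShift K) p‖ ≤ A) (hA : 4 * A < B.Dtmin) (hA20 : 4 * A ≤ 1 / 20) (hμ : μ ≤ -0.15)
    (n : ℕ) {t : ℝ} (ht : t ∈ Icc (0 : ℝ) 1) (hβ : klBetaMin ≤ β) (hβL : β ≤ L) (hn : n + 1 ≤ nScales β + 1)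
    (hM : β * (4 * klScale klE0 (n + 1)) / (2 * Real.pi) + 1 ≤ M)
    (Wd : ℝ → FreqMomentum L M → ℝ) (hWd : Wd = fun t k => deriv (fun Λ' : ℝ => hubbardCutoffWeightCT L M β μ K Λ' k) (klScale klE0 n + t * (klScale klE0 (n + 1) - klScale klE0 n)))
    (V : ℕ → ℝ → (Fin 4 → HubbardFieldIdx L M) → ℂ) {j : ℕ} (hj : n + 2 ≤ j) (Qm x y : TorusSite 2 L)
    (hlo : a' < μ - 4 * klScale klE0 (n + 1) - 4 * A) (hhi : μ + 4 * klScale klE0 (n + 1) + 4 * A < b')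
    (hq : (4 + 8 / 3 * R.Gfr 1 * U ^ 2) * klTorusNorm L (x - y) ≤ klScale klE0 (n + 1) / 8)
    (c : ℂ) (F₁ F₂ : FreqMomentum L M → Fin 2 → FreqMomentum L M → ℂ) (F₁₀ : TorusSite 2 L → Fin 2 → TorusSite 2 L → ℂ)
    (hsplit : ∀ (p : FreqMomentum L M) (σ : Fin 2) (p' : FreqMomentum L M),
      V j t ![((p, σ), 1), ((p', σ), 0), (((omega0 M, y), 0), 0), (((omega0 M, x), 0), 1)] *
          V j t ![((p, σ), 0), ((p', σ), 1), ((((omega0 M).rev, Qm - y), 1), 0), ((((omega0 M).rev, Qm - x), 1), 1)] = c + F₁ p σ p' + F₂ p σ p')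
    {A₁ L₁ ε₁ : ℝ} (hA1 : 0 ≤ A₁) (hL1 : 0 ≤ L₁) (hε1 : 0 ≤ ε₁)
    (hY0p₁ : ∀ k : TorusSite 2 L, ‖∑ σ : Fin 2, F₁₀ k σ (k + (x - y))‖ ≤ A₁)
    (hY1p₁ : ∀ k k' : TorusSite 2 L, ‖(∑ σ : Fin 2, F₁₀ k σ (k + (x - y))) - ∑ σ : Fin 2, F₁₀ k' σ (k' + (x - y))‖ ≤ L₁ * klTorusNorm L (k - k'))
    (hY0m₁ : ∀ k : TorusSite 2 L, ‖∑ σ : Fin 2, F₁₀ (k + -(x - y)) σ k‖ ≤ A₁)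
    (hY1m₁ : ∀ k k' : TorusSite 2 L, ‖(∑ σ : Fin 2, F₁₀ (k + -(x - y)) σ k) - ∑ σ : Fin 2, F₁₀ (k' + -(x - y)) σ k'‖ ≤ L₁ * klTorusNorm L (k - k'))
    (hflat₁ : ∀ (i : MatsubaraIdx M) (σ : Fin 2) (k k' : TorusSite 2 L), matsubaraFreq β M i ^ 2 ≤ (4 * klScale klE0 (n + 1)) ^ 2 →
      ‖F₁ (i, k) σ (i, k') - F₁₀ k σ k'‖ ≤ ε₁)
    (cen : TorusSite 2 L) {ρ A₂ : ℝ} (hρ : 0 ≤ ρ) (hA2 : 0 ≤ A₂)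
    (hF₂ : ∀ (p : FreqMomentum L M) (σ : Fin 2) (p' : FreqMomentum L M), ‖F₂ p σ p'‖ ≤ A₂)
    (hsupp₂ : ∀ (p : FreqMomentum L M) (σ : Fin 2) (p' : FreqMomentum L M), ρ < klTorusNorm L (p.2 - cen) → F₂ p σ p' = 0) :
    (klScale klE0 n - klScale klE0 (n + 1)) * ((β * (L : ℝ) ^ 2) ^ 3)⁻¹ *
        ‖∑ p : FreqMomentum L M, ∑ σ : Fin 2, ∑ p' : FreqMomentum L M,
          if matsubaraInt M p'.1 + matsubaraInt M (omega0 M) = matsubaraInt M p.1 + matsubaraInt M (omega0 M) ∧ p'.2 = p.2 + x - y then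
            ((((((softSymbolCompl L M β μ K (n + 1) j p - softSymbolCompl L M β μ K (n + 1) (n + 1) p) : ℝ) : ℂ) * (((β * (L : ℝ) ^ 2 : ℝ) : ℂ) * propCT L M β μ K p)) *
                  ((((Wd t p') : ℝ) : ℂ) * (((β * (L : ℝ) ^ 2 : ℝ) : ℂ) * propCT L M β μ K p'))) +
                (((((Wd t p) : ℝ) : ℂ) * (((β * (L : ℝ) ^ 2 : ℝ) : ℂ) * propCT L M β μ K p)) *
                  ((((softSymbolCompl L M β μ K (n + 1) j p' - softSymbolCompl L M β μ K (n + 1) (n + 1) p') : ℝ) : ℂ) * (((β * (L : ℝ) ^ 2 : ℝ) : ℂ) * propCT L M β μ K p')))) *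
              (V j t ![((p, σ), 1), ((p', σ), 0), (((omega0 M, y), 0), 0), (((omega0 M, x), 0), 1)] *
                V j t ![((p, σ), 0), ((p', σ), 1), ((((omega0 M).rev, Qm - y), 1), 0), ((((omega0 M).rev, Qm - x), 1), 1)])
          else 0‖ ≤
      2 * ((klScale klE0 n - klScale klE0 (n + 1)) *
          klmsRowBoundS B.Dtmin A (4 + 8 / 3 * R.Gfr 1 * U ^ 2) (2 * ‖c‖) 0 β n (n + 2) ((4 + 8 / 3 * R.Gfr 1 * U ^ 2) * klTorusNorm L (x - y)) L) +
        2 * ((klScale klE0 n - klScale klE0 (n + 1)) *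
          klmsRowBoundS B.Dtmin A (4 + 8 / 3 * R.Gfr 1 * U ^ 2) A₁ L₁ β n (n + 2) ((4 + 8 / 3 * R.Gfr 1 * U ^ 2) * klTorusNorm L (x - y)) L) +
        ε₁ * (512 * 15367) + A₂ * (1024 * 15381) * (ρ / π + ((L : ℝ))⁻¹) := by
  have hβ0 : 0 < β := lt_of_lt_of_le (by norm_num [klBetaMin]) hβ
  have hL : (0 : ℝ) < L := by exact_mod_cast Nat.pos_of_ne_zero (NeZero.ne L)
  have hBL : β * (L : ℝ) ^ 2 ≠ 0 := by positivity
  have hκ : 0 ≤ (klScale klE0 n - klScale klE0 (n + 1)) * ((β * (L : ℝ) ^ 2) ^ 3)⁻¹ := by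
    refine mul_nonneg ?_ (by positivity)
    rw [klth_klScale_succ]; linarith [klth_klScale_pos n]
  have h := dLine_pinned_direct_signed_le_split3S β μ K B hR hK hAb hA hA20 hμ n ht hβ hβL hn hM Wd hWd V hj Qm x y hlo hhi hq c F₁ F₂ F₁₀ hsplit
    hA1 hL1 hε1 hY0p₁ hY1p₁ hY0m₁ hY1m₁ hflat₁ cen hρ hA2 hF₂ hsupp₂
  have hE := pinned_flat_le (M := M) β μ K hK hβ hβL n ht hε1 (C := 512 / 3) (by norm_num) le_rfl
  have hW := window_flat_le (L := L) β hβ0 n (m := n + 1) le_rfl ht hA2 (C := 512 / 3) le_rfl hρ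
  have hmain := door_split3_arith hBL h hκ hE hW
  linarith [hmain]

/-- **CROSSED THREE-WAY SPLIT ROW IN THE DOOR's NORMALISATION**: `(Λₙ−Λₙ₊₁)((βL²)³)⁻¹·‖S_{D,x}‖ ≤ (Λₙ−Λₙ₊₁)(Row_{n+2}(‖c‖,0; δ₋) + Row_{n+2}(‖c‖,0; δ₊)) +
(Λₙ−Λₙ₊₁)(Row_{n+2}(A₁,L₁; δ₋) + Row_{n+2}(A₁,L₁; δ₊)) + ε₁·(512·15367) + A₂·(1024·15381)·(ρ/π + 1/L)`, `δ∓ = |∓2π/β| + G·|p_{Q_m−x−y}|_𝕋` (the ROOM rows are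
`pinned_row_le_slots_shiftS`'s input). -/
theorem dLine_pinned_crossed_split3_doorS (hR : ∀ j, 0 ≤ R.Gfr j) (hK : FrameOK R U N μ K)
    (hAb : ∀ p : Momentum, ∀ j ≤ 2, ‖iteratedFDeriv ℝ j (frameShift K) p‖ ≤ A) (hA : 4 * A < B.Dtmin) (hA20 : 4 * A ≤ 1 / 20) (hμ : μ ≤ -0.15)
    (n : ℕ) {t : ℝ} (ht : t ∈ Icc (0 : ℝ) 1) (hβ : klBetaMin ≤ β) (hβL : β ≤ L) (hn : n + 1 ≤ nScales β + 1) (hβn : 16 * π / β ≤ klScale klE0 (n + 1))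
    (hM : β * (4 * klScale klE0 (n + 1)) / (2 * Real.pi) + 1 ≤ M)
    (Wd : ℝ → FreqMomentum L M → ℝ) (hWd : Wd = fun t k => deriv (fun Λ' : ℝ => hubbardCutoffWeightCT L M β μ K Λ' k) (klScale klE0 n + t * (klScale klE0 (n + 1) - klScale klE0 n)))
    (V : ℕ → ℝ → (Fin 4 → HubbardFieldIdx L M) → ℂ) {j : ℕ} (hj : n + 2 ≤ j) (Qm x y : TorusSite 2 L)
    (hlo : a' < μ - 4 * klScale klE0 (n + 1) - 4 * A) (hhi : μ + 4 * klScale klE0 (n + 1) + 4 * A < b')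
    (hq : (4 + 8 / 3 * R.Gfr 1 * U ^ 2) * klTorusNorm L (Qm - x - y) ≤ klScale klE0 (n + 1) / 16)
    (c : ℂ) (F₁ F₂ : FreqMomentum L M → FreqMomentum L M → ℂ) (F₁₀ : TorusSite 2 L → TorusSite 2 L → ℂ)
    (hsplit : ∀ (p p' : FreqMomentum L M),
      V j t ![((p, 0), 1), ((p', 1), 0), (((omega0 M, y), 0), 0), ((((omega0 M).rev, Qm - x), 1), 1)] *
          V j t ![((p, 0), 0), ((p', 1), 1), ((((omega0 M).rev, Qm - y), 1), 0), (((omega0 M, x), 0), 1)] = c + F₁ p p' + F₂ p p')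
    {A₁ L₁ ε₁ : ℝ} (hA1 : 0 ≤ A₁) (hL1 : 0 ≤ L₁) (hε1 : 0 ≤ ε₁)
    (hY0B₁ : ∀ k : TorusSite 2 L, ‖F₁₀ k (k + (Qm - x - y))‖ ≤ A₁)
    (hY1B₁ : ∀ k k' : TorusSite 2 L, ‖F₁₀ k (k + (Qm - x - y)) - F₁₀ k' (k' + (Qm - x - y))‖ ≤ L₁ * klTorusNorm L (k - k'))
    (hY0A₁ : ∀ k : TorusSite 2 L, ‖F₁₀ (k + -(Qm - x - y)) k‖ ≤ A₁)
    (hY1A₁ : ∀ k k' : TorusSite 2 L, ‖F₁₀ (k + -(Qm - x - y)) k - F₁₀ (k' + -(Qm - x - y)) k'‖ ≤ L₁ * klTorusNorm L (k - k'))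
    (hflat₁ : ∀ (i i' : MatsubaraIdx M) (k k' : TorusSite 2 L), matsubaraInt M i' + 1 = matsubaraInt M i →
      matsubaraFreq β M i ^ 2 ≤ (5 * klScale klE0 (n + 1)) ^ 2 → ‖F₁ (i, k) (i', k') - F₁₀ k k'‖ ≤ ε₁)
    (cen : TorusSite 2 L) {ρ A₂ : ℝ} (hρ : 0 ≤ ρ) (hA2 : 0 ≤ A₂)
    (hF₂ : ∀ (p p' : FreqMomentum L M), ‖F₂ p p'‖ ≤ A₂)
    (hsupp₂ : ∀ (p p' : FreqMomentum L M), ρ < klTorusNorm L (p.2 - cen) → F₂ p p' = 0) :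
    (klScale klE0 n - klScale klE0 (n + 1)) * ((β * (L : ℝ) ^ 2) ^ 3)⁻¹ *
        ‖∑ p : FreqMomentum L M, ∑ p' : FreqMomentum L M,
          if matsubaraInt M p'.1 + matsubaraInt M (omega0 M) + matsubaraInt M (omega0 M) + 1 = matsubaraInt M p.1 ∧ p'.2 = p.2 + Qm - x - y then
            ((((((softSymbolCompl L M β μ K (n + 1) j p - softSymbolCompl L M β μ K (n + 1) (n + 1) p) : ℝ) : ℂ) * (((β * (L : ℝ) ^ 2 : ℝ) : ℂ) * propCT L M β μ K p)) *
                  ((((Wd t p') : ℝ) : ℂ) * (((β * (L : ℝ) ^ 2 : ℝ) : ℂ) * propCT L M β μ K p'))) +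
                (((((Wd t p) : ℝ) : ℂ) * (((β * (L : ℝ) ^ 2 : ℝ) : ℂ) * propCT L M β μ K p)) *
                  ((((softSymbolCompl L M β μ K (n + 1) j p' - softSymbolCompl L M β μ K (n + 1) (n + 1) p') : ℝ) : ℂ) * (((β * (L : ℝ) ^ 2 : ℝ) : ℂ) * propCT L M β μ K p')))) *
              (V j t ![((p, 0), 1), ((p', 1), 0), (((omega0 M, y), 0), 0), ((((omega0 M).rev, Qm - x), 1), 1)] *
                V j t ![((p, 0), 0), ((p', 1), 1), ((((omega0 M).rev, Qm - y), 1), 0), (((omega0 M, x), 0), 1)])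
          else 0‖ ≤
      ((klScale klE0 n - klScale klE0 (n + 1)) *
            klmsRowBoundS B.Dtmin A (4 + 8 / 3 * R.Gfr 1 * U ^ 2) ‖c‖ 0 β n (n + 2) (|-(2 * π / β)| + (4 + 8 / 3 * R.Gfr 1 * U ^ 2) * klTorusNorm L (Qm - x - y)) L +
          (klScale klE0 n - klScale klE0 (n + 1)) *
            klmsRowBoundS B.Dtmin A (4 + 8 / 3 * R.Gfr 1 * U ^ 2) ‖c‖ 0 β n (n + 2) (|2 * π / β| + (4 + 8 / 3 * R.Gfr 1 * U ^ 2) * klTorusNorm L (Qm - x - y)) L) +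
        ((klScale klE0 n - klScale klE0 (n + 1)) *
            klmsRowBoundS B.Dtmin A (4 + 8 / 3 * R.Gfr 1 * U ^ 2) A₁ L₁ β n (n + 2) (|-(2 * π / β)| + (4 + 8 / 3 * R.Gfr 1 * U ^ 2) * klTorusNorm L (Qm - x - y)) L +
          (klScale klE0 n - klScale klE0 (n + 1)) *
            klmsRowBoundS B.Dtmin A (4 + 8 / 3 * R.Gfr 1 * U ^ 2) A₁ L₁ β n (n + 2) (|2 * π / β| + (4 + 8 / 3 * R.Gfr 1 * U ^ 2) * klTorusNorm L (Qm - x - y)) L) +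
        ε₁ * (512 * 15367) + A₂ * (1024 * 15381) * (ρ / π + ((L : ℝ))⁻¹) := by
  have hβ0 : 0 < β := lt_of_lt_of_le (by norm_num [klBetaMin]) hβ
  have hL : (0 : ℝ) < L := by exact_mod_cast Nat.pos_of_ne_zero (NeZero.ne L)
  have hBL : β * (L : ℝ) ^ 2 ≠ 0 := by positivity
  have hκ : 0 ≤ (klScale klE0 n - klScale klE0 (n + 1)) * ((β * (L : ℝ) ^ 2) ^ 3)⁻¹ := by
    refine mul_nonneg ?_ (by positivity)
    rw [klth_klScale_succ]; linarith [klth_klScale_pos n]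
  have h := dLine_pinned_crossed_signed_le_split3S β μ K B hR hK hAb hA hA20 hμ n ht hβ hβL hn hβn hM Wd hWd V hj Qm x y hlo hhi hq c F₁ F₂ F₁₀ hsplit
    hA1 hL1 hε1 hY0B₁ hY1B₁ hY0A₁ hY1A₁ hflat₁ cen hρ hA2 hF₂ hsupp₂
  have hE := pinned_flat_le (M := M) β μ K hK hβ hβL n ht hε1 (C := 256 / 3) (by norm_num) (by norm_num)
  have hW := window_flat_le (L := L) β hβ0 n (m := n + 1) le_rfl ht hA2 (C := 256 / 3) (by norm_num) hρ
  exact door_split3_arith hBL h hκ hE hW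

end Door


end Summit.HubbardSuperconductivity.HubbardSuperconductivity.Theorems.KLRegimeSplit

end
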